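import Summits.AtomisticToContinuum.Crystallization.Theorems.OverbindingBudgetStackedRigidityW

/-!
# OverbindingBudget · decomp-a2c lens-4 g31 — part XIX-K: the EXISTENCE KERNEL for the balanced reference (slot 7d, analytic half)

Helper file under `--supports stmt-AtomisticToContinuum-31280` (RDEF = `Theses.OverbindingBudget.RobustDefectLimitWindows`); companion of
`OverbindingBudgetStackedRigidityRef` (critic row 457, R3).  Nothing here closes RDEF.

Part XVIII proved the UNIQUENESS kernel `eq_of_equal_stress`: on a window product with lens-3's tube data (`λ`-strong monotonicity of each gap
map in its own slot, `ℓ¹`-Lipschitz cross-slot bound with weights `κ ≥ 0`, `Σκ − κ₀ < λ`) two profiles with equal gap maps coincide.  This file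
proves the matching EXISTENCE kernel (lens-4 move: the balanced reference IS the unique fixed point of the damped gap-stress iteration):

* `exists_zero_of_tube_data` — abstract gap map `Φ` with the tube data on the windows `closedBall (c m) r` round an arbitrary CENTRE PROFILE `c`,
  cross-gap mass `Σκ − κ₀ ≤ ρ < λ`, and RESIDUAL `‖Φ m c‖ ≤ ε` at the centre with `4ε ≤ 3(λ − ρ)r` ⇒ a window profile `h` with `Φ m h = 0` across
  every gap and `‖h m − c m‖ ≤ 4ε / (3(λ − ρ))`.  Proof: the damped iteration `h ↦ (m ↦ h m − t • Φ m h)`, `t := (λ − ρ)/(2(κ₀² + λ²))`, is a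
  `q`-contraction of the window product in the sup-distance, `q = 1 − t(λ − ρ) + t²κ₀²/2 < 1` (own slot: `‖u − t v‖² ≤ (1 − 2tλ + t²κ₀²)‖u‖²`
  from strong monotonicity and the `κ₀`-Lipschitz bound; other slots: `t·ρ·sup`); it stays in the windows by the residual bound, and the
  pointwise limit is a zero (all bounds in the `D`-form of part XVIII — no function spaces). [folklore: Zarantonello / Browder–Minty
  contraction for strongly monotone Lipschitz maps, here slot-wise with `ℓ¹` off-diagonal control]
* `exists_zeroStress_of_tube_data` — the LJ specialisation `Φ := gapStress a b`: a ZERO-STRESS increment profile within `4ε/(3(λ − ρ))` of any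
  centre `c` with residual `ε` (the balanced reference);  `zero_unique_of_tube_data` — it is the only zero in the windows.

USE (slot 7d `BasalReferenceW Λ₁ ρ₁` / `BasalReferenceCW`): at the registry centre `ĉ` (hollow registry of the pinned in-plane cell + the
stress-free gap of the uniform stack) the residual is the per-gap deviation only, so 7d ⟸ [residual cert at `ĉ`] ∧ [tube data on the `r`-ball
round `ĉ`, `r ≤ ρ⋆`] ∧ [in-plane pinning of `(a, b)` by `StressFree`] ∧ [metric check: profiles within `4ε/(3(λ−ρ))` of `ĉ` are uniformly
clean] — to be typed once lens-3's registry frame (StackedUniform / S-registry corollary) is importable; an EXISTENTIALLY chosen centre would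
degenerate (`c := incr w`, `ε := 0`) to the parent statement, which is why the kernel, not a cut, is landed here.
-/

noncomputable section

namespace Summit.AtomisticToContinuum.Crystallization.Theorems.OverbindingBudgetBalancedReferenceKernel

open Metric Filter Topology
open scoped RealInnerProductSpace
open Summit.AtomisticToContinuum.Crystallization.Theorems.ChartedPlanarOrderChunkFloor (E3)
open Summit.AtomisticToContinuum.Crystallization.Theorems.ChartedPlanarOrderProfileSlavingLJ (gapStress)
open Summit.AtomisticToContinuum.Crystallization.Theorems.OverbindingBudgetStackedRigidityW (eq_of_equal_stress)

/-! ## The existence kernel: a zero of the gap map in the tube round a centre with small residual -/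

/-- Telescoping bound: steps `‖f (i+1) − f i‖ ≤ g i` for `i < n` give `‖f n − f 0‖ ≤ Σ_{i<n} g i`. [folklore] -/
theorem norm_sub_le_sum_range {f : ℕ → E3} {g : ℕ → ℝ} (n : ℕ) (h : ∀ i < n, ‖f (i + 1) - f i‖ ≤ g i) :
    ‖f n - f 0‖ ≤ ∑ i ∈ Finset.range n, g i := by
  induction n with
  | zero => simp
  | succ n ih =>
    rw [Finset.sum_range_succ]
    calc ‖f (n + 1) - f 0‖ = ‖(f (n + 1) - f n) + (f n - f 0)‖ := by rw [sub_add_sub_cancel]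
      _ ≤ ‖f (n + 1) - f n‖ + ‖f n - f 0‖ := norm_add_le _ _
      _ ≤ g n + ∑ i ∈ Finset.range n, g i :=
          add_le_add (h n (Nat.lt_succ_self n)) (ih fun i hi => h i (Nat.lt_succ_of_lt hi))
      _ = (∑ i ∈ Finset.range n, g i) + g n := add_comm _ _

/-- **Own-slot contraction estimate.** `λ‖u‖² ≤ ⟪v, u⟫` and `‖v‖ ≤ κ₀‖u‖` give `‖u − t•v‖ ≤ (1 − tλ + t²κ₀²/2)‖u‖` whenever `0 ≤ t` and
`tλ ≤ 1/2`. [folklore] -/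
theorem norm_sub_smul_le_of_monotone {u v : E3} {lam κ₀ t : ℝ} (ht : 0 ≤ t) (htl : t * lam ≤ 1 / 2)
    (hmo : lam * ‖u‖ ^ 2 ≤ ⟪v, u⟫) (hli : ‖v‖ ≤ κ₀ * ‖u‖) :
    ‖u - t • v‖ ≤ (1 - t * lam + t ^ 2 * κ₀ ^ 2 / 2) * ‖u‖ := by
  have hsq : ‖u - t • v‖ ^ 2 = ‖u‖ ^ 2 - 2 * t * ⟪v, u⟫ + t ^ 2 * ‖v‖ ^ 2 := by
    rw [norm_sub_sq_real, inner_smul_right, norm_smul, Real.norm_eq_abs, abs_of_nonneg ht, real_inner_comm]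
    ring
  have hv2 : ‖v‖ ^ 2 ≤ (κ₀ * ‖u‖) ^ 2 := by gcongr
  have h1 : ‖u - t • v‖ ^ 2 ≤ (1 - 2 * t * lam + t ^ 2 * κ₀ ^ 2) * ‖u‖ ^ 2 := by
    rw [hsq]
    have e1 := mul_le_mul_of_nonneg_left hmo (by positivity : (0 : ℝ) ≤ 2 * t)
    have e2 := mul_le_mul_of_nonneg_left hv2 (by positivity : (0 : ℝ) ≤ t ^ 2)
    nlinarith
  -- `1 − 2A ≤ (1 − A)²` with `A := tλ − t²κ₀²/2`, and `1 − A ≥ 1/2 ≥ 0`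
  have hA : 0 ≤ 1 - t * lam + t ^ 2 * κ₀ ^ 2 / 2 := by nlinarith [sq_nonneg (t * κ₀)]
  have hB : 0 ≤ (1 - t * lam + t ^ 2 * κ₀ ^ 2 / 2) * ‖u‖ := mul_nonneg hA (norm_nonneg u)
  have h2 : ‖u - t • v‖ ^ 2 ≤ ((1 - t * lam + t ^ 2 * κ₀ ^ 2 / 2) * ‖u‖) ^ 2 :=
    h1.trans (by nlinarith [mul_nonneg (sq_nonneg (t * lam - t ^ 2 * κ₀ ^ 2 / 2)) (sq_nonneg ‖u‖)])
  have h3 := abs_le_of_sq_le_sq h2 hB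
  rwa [abs_of_nonneg (norm_nonneg _)] at h3
set_option maxHeartbeats 400000 in
/-- **EXISTENCE KERNEL, PROVED.**  Abstract gap map `Φ` with lens-3's tube data on the windows `closedBall (c m) r` round a centre profile `c`
(`λ`-strong monotonicity in the own increment, `ℓ¹`-Lipschitz with weights `κ ≥ 0`, cross-gap mass `Σκ − κ₀ ≤ ρ < λ`) and residual `‖Φ m c‖ ≤ ε`
with `4ε ≤ 3(λ − ρ)r`: there is a window profile with `Φ ≡ 0` across every gap, within `4ε/(3(λ − ρ))` of the centre.  (Damped iteration
`h ↦ h − t•Φ h`, `t = (λ−ρ)/(2(κ₀²+λ²))`, contraction factor `1 − t(λ−ρ) + t²κ₀²/2`.) [folklore] -/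
theorem exists_zero_of_tube_data {c : ℤ → E3} {r ε lam ρ : ℝ} {Φ : ℤ → (ℤ → E3) → E3} {κ : ℤ → ℝ}
    (hε0 : 0 ≤ ε) (hκ0 : ∀ j, 0 ≤ κ j) (hκs : Summable κ) (hρ : (∑' j, κ j) - κ 0 ≤ ρ) (hρl : ρ < lam)
    (hmono : ∀ m : ℤ, ∀ h : ℤ → E3, (∀ k, h k ∈ closedBall (c k) r) → ∀ b' ∈ closedBall (c m) r,
      lam * ‖h m - b'‖ ^ 2 ≤ ⟪Φ m h - Φ m (Function.update h m b'), h m - b'⟫)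
    (hlip : ∀ m : ℤ, ∀ h h' : ℤ → E3, (∀ k, h k ∈ closedBall (c k) r) → (∀ k, h' k ∈ closedBall (c k) r) →
      ‖Φ m h - Φ m h'‖ ≤ ∑' j : ℤ, κ j * ‖h (m + j) - h' (m + j)‖)
    (hres : ∀ m, ‖Φ m c‖ ≤ ε) (hεr : 4 * ε ≤ 3 * (lam - ρ) * r) :
    ∃ h : ℤ → E3, (∀ k, h k ∈ closedBall (c k) r) ∧ (∀ m, Φ m h = 0) ∧ ∀ k, ‖h k - c k‖ ≤ 4 * ε / (3 * (lam - ρ)) := by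
  classical
  -- constants
  have hρ0 : 0 ≤ ρ := by
    have h1 : ∑ j ∈ ({0} : Finset ℤ), κ j ≤ ∑' j, κ j := hκs.sum_le_tsum {0} (fun j _ => hκ0 j)
    rw [Finset.sum_singleton] at h1
    linarith
  have hlam : 0 < lam := lt_of_le_of_lt hρ0 hρl
  have hgap : 0 < lam - ρ := sub_pos.mpr hρl
  have hr0 : 0 ≤ r := by
    by_contra hr
    have hr' : r < 0 := not_le.mp hr
    nlinarith [mul_pos (mul_pos (by norm_num : (0:ℝ) < 3) hgap) (neg_pos.mpr hr')]
  set K : ℝ := κ 0 ^ 2 + lam ^ 2 with hK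
  have hK0 : 0 < K := by positivity
  have hκK : κ 0 ^ 2 ≤ K := by rw [hK]; nlinarith
  have hlK : lam ^ 2 ≤ K := by rw [hK]; nlinarith [sq_nonneg (κ 0)]
  set t : ℝ := (lam - ρ) / (2 * K) with ht
  have ht0 : 0 < t := div_pos hgap (by positivity)
  have htl : t * lam ≤ 1 / 2 := by
    rw [ht, div_mul_eq_mul_div, div_le_iff₀ (by positivity)]
    nlinarith [mul_nonneg hρ0 hlam.le]
  have htκ' : t * κ 0 ^ 2 ≤ (lam - ρ) / 2 :=
    calc t * κ 0 ^ 2 ≤ t * K := mul_le_mul_of_nonneg_left hκK ht0.le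
      _ = (lam - ρ) / 2 := by rw [ht]; field_simp
  have htκ : t * κ 0 ^ 2 / 2 ≤ (lam - ρ) / 4 := by linarith
  set q₁ : ℝ := 1 - t * lam + t ^ 2 * κ 0 ^ 2 / 2 with hq₁
  set q : ℝ := q₁ + t * ρ with hq
  have hq_eq : 1 - q = t * ((lam - ρ) - t * κ 0 ^ 2 / 2) := by rw [hq, hq₁]; ring
  have h1q : 3 / 4 * (t * (lam - ρ)) ≤ 1 - q := by
    rw [hq_eq]; nlinarith [mul_le_mul_of_nonneg_left htκ ht0.le]
  have h1q0 : 0 < 1 - q := lt_of_lt_of_le (by nlinarith [mul_pos ht0 hgap]) h1q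
  have hq1 : q < 1 := by linarith
  have hq₁0 : 0 ≤ q₁ := by rw [hq₁]; nlinarith [sq_nonneg (t * κ 0)]
  have hq0 : 0 ≤ q := by rw [hq]; nlinarith [mul_nonneg ht0.le hρ0]
  -- the damped step (opaque, with its defining equation) and its contraction property (D-form)
  obtain ⟨step, hstep⟩ : ∃ step : (ℤ → E3) → ℤ → E3, ∀ h m, step h m = h m - t • Φ m h := ⟨fun h m => h m - t • Φ m h, fun _ _ => rfl⟩
  have hsumm : ∀ h h' : ℤ → E3, (∀ k, h k ∈ closedBall (c k) r) → (∀ k, h' k ∈ closedBall (c k) r) →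
      ∀ m, Summable (fun j : ℤ => κ j * ‖h (m + j) - h' (m + j)‖) := by
    intro h h' hh hh' m
    refine Summable.of_nonneg_of_le (fun j => mul_nonneg (hκ0 j) (norm_nonneg _)) (fun j => ?_) (hκs.mul_right (2 * r))
    refine mul_le_mul_of_nonneg_left ?_ (hκ0 j)
    have h1 := hh (m + j); have h2 := hh' (m + j)
    rw [mem_closedBall, dist_eq_norm] at h1 h2
    calc ‖h (m + j) - h' (m + j)‖ = ‖(h (m + j) - c (m + j)) - (h' (m + j) - c (m + j))‖ := by congr 1; abel
      _ ≤ ‖h (m + j) - c (m + j)‖ + ‖h' (m + j) - c (m + j)‖ := norm_sub_le _ _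
      _ ≤ 2 * r := by linarith
  have key : ∀ h h' : ℤ → E3, (∀ k, h k ∈ closedBall (c k) r) → (∀ k, h' k ∈ closedBall (c k) r) →
      ∀ D : ℝ, (∀ k, ‖h k - h' k‖ ≤ D) → ∀ m, ‖step h m - step h' m‖ ≤ q * D := by
    intro h h' hh hh' D hD m
    have hD0 : 0 ≤ D := (norm_nonneg _).trans (hD 0)
    set g : ℤ → E3 := Function.update h m (h' m) with hg
    have hgW : ∀ k, g k ∈ closedBall (c k) r := fun k => by
      rcases eq_or_ne k m with rfl | hne
      · rw [hg, Function.update_self]; exact hh' k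
      · rw [hg, Function.update_of_ne hne]; exact hh k
    -- own slot
    have hmo : lam * ‖h m - h' m‖ ^ 2 ≤ ⟪Φ m h - Φ m g, h m - h' m⟫ := hmono m h hh (h' m) (hh' m)
    have hvle : ‖Φ m h - Φ m g‖ ≤ κ 0 * ‖h m - h' m‖ := by
      have hli := hlip m h g hh hgW
      have hzero : ∀ j : ℤ, j ≠ 0 → κ j * ‖h (m + j) - g (m + j)‖ = 0 := by
        intro j hj
        have hne : m + j ≠ m := by intro hc; exact hj (by linarith)
        rw [hg, Function.update_of_ne hne, sub_self, norm_zero, mul_zero]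
      rw [tsum_eq_single 0 hzero] at hli
      simpa [hg] using hli
    have hown : ‖(h m - h' m) - t • (Φ m h - Φ m g)‖ ≤ q₁ * ‖h m - h' m‖ :=
      norm_sub_smul_le_of_monotone ht0.le htl hmo hvle
    -- other slots
    have hterm : ∀ j : ℤ, κ j * ‖g (m + j) - h' (m + j)‖ ≤ κ j * D - if j = 0 then κ 0 * D else 0 := by
      intro j
      by_cases hj : j = 0
      · subst hj
        simp [hg]
      · rw [if_neg hj, sub_zero]
        refine mul_le_mul_of_nonneg_left ?_ (hκ0 j)
        have hne : m + j ≠ m := by intro hc; exact hj (by linarith)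
        rw [hg, Function.update_of_ne hne]
        exact hD (m + j)
    have hite : HasSum (fun j : ℤ => if j = 0 then κ 0 * D else 0) (κ 0 * D) := hasSum_ite_eq 0 _
    have hsum2 : Summable (fun j : ℤ => κ j * D - if j = 0 then κ 0 * D else 0) := (hκs.mul_right D).sub hite.summable
    have hbound : ∑' j : ℤ, κ j * ‖g (m + j) - h' (m + j)‖ ≤ ρ * D := by
      calc ∑' j : ℤ, κ j * ‖g (m + j) - h' (m + j)‖ ≤ ∑' j : ℤ, (κ j * D - if j = 0 then κ 0 * D else 0) :=
            (hsumm g h' hgW hh' m).tsum_le_tsum hterm hsum2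
        _ = (∑' j : ℤ, κ j * D) - ∑' j : ℤ, (if j = 0 then κ 0 * D else 0) := (hκs.mul_right D).tsum_sub hite.summable
        _ = ((∑' j, κ j) - κ 0) * D := by rw [tsum_mul_right, hite.tsum_eq]; ring
        _ ≤ ρ * D := mul_le_mul_of_nonneg_right hρ hD0
    have hcross : ‖Φ m g - Φ m h'‖ ≤ ρ * D := (hlip m g h' hgW hh').trans hbound
    -- assemble
    have hdec : step h m - step h' m = ((h m - h' m) - t • (Φ m h - Φ m g)) - t • (Φ m g - Φ m h') := by
      rw [hstep, hstep, smul_sub, smul_sub]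
      abel
    have huD : ‖h m - h' m‖ ≤ D := hD m
    calc ‖step h m - step h' m‖ = ‖((h m - h' m) - t • (Φ m h - Φ m g)) - t • (Φ m g - Φ m h')‖ := by rw [hdec]
      _ ≤ ‖(h m - h' m) - t • (Φ m h - Φ m g)‖ + ‖t • (Φ m g - Φ m h')‖ := norm_sub_le _ _
      _ ≤ q₁ * ‖h m - h' m‖ + t * (ρ * D) := by
          refine add_le_add hown ?_
          rw [norm_smul, Real.norm_eq_abs, abs_of_pos ht0]
          exact mul_le_mul_of_nonneg_left hcross ht0.le
      _ ≤ q₁ * D + t * (ρ * D) := by nlinarith [mul_le_mul_of_nonneg_left huD hq₁0]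
      _ = q * D := by rw [hq]; ring
  -- the iteration (opaque, with its defining equations)
  obtain ⟨iter, iter_zero, iter_succ⟩ : ∃ iter : ℕ → ℤ → E3, iter 0 = c ∧ ∀ n, iter (n + 1) = step (iter n) :=
    ⟨fun n => step^[n] c, rfl, fun n => Function.iterate_succ_apply' step n c⟩
  set C : ℝ := t * ε with hC
  have hC0 : 0 ≤ C := by positivity
  have hCr : C / (1 - q) ≤ r := by
    rw [div_le_iff₀ h1q0, hC]
    nlinarith [mul_le_mul_of_nonneg_left hεr ht0.le, mul_le_mul_of_nonneg_left h1q hr0]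
  -- geometric partial sums
  have geom : ∀ n : ℕ, ∑ i ∈ Finset.range n, C * q ^ i ≤ C / (1 - q) := by
    intro n
    have hs : HasSum (fun i : ℕ => C * q ^ i) (C / (1 - q)) := by
      rw [div_eq_mul_inv]; exact (hasSum_geometric_of_lt_one hq0 hq1).mul_left C
    exact sum_le_hasSum (Finset.range n) (fun i _ => by positivity) hs
  -- invariant: all iterates in the windows and successive differences geometric
  have inv : ∀ n : ℕ, (∀ i ≤ n, ∀ k, iter i k ∈ closedBall (c k) r) ∧
      (∀ i ≤ n, ∀ k, ‖iter (i + 1) k - iter i k‖ ≤ C * q ^ i) := by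
    intro n
    induction n with
    | zero =>
      refine ⟨fun i hi k => ?_, fun i hi k => ?_⟩
      · obtain rfl : i = 0 := Nat.le_zero.mp hi
        rw [iter_zero]; exact mem_closedBall_self hr0
      · obtain rfl : i = 0 := Nat.le_zero.mp hi
        rw [zero_add, iter_succ, iter_zero, pow_zero, mul_one, hC, hstep, sub_sub_cancel_left, norm_neg, norm_smul,
          Real.norm_eq_abs, abs_of_pos ht0]
        exact mul_le_mul_of_nonneg_left (hres k) ht0.le
    | succ n ih =>
      obtain ⟨ihW, ihd⟩ := ih
      -- iter (n+1) is in the windows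
      have hWn1 : ∀ k, iter (n + 1) k ∈ closedBall (c k) r := by
        intro k
        rw [mem_closedBall, dist_eq_norm]
        have htel : ‖iter (n + 1) k - iter 0 k‖ ≤ ∑ i ∈ Finset.range (n + 1), C * q ^ i :=
          norm_sub_le_sum_range (f := fun i => iter i k) (n + 1) fun i hi => ihd i (Nat.lt_succ_iff.mp hi) k
        rw [iter_zero] at htel
        exact htel.trans ((geom (n + 1)).trans hCr)
      refine ⟨fun i hi k => ?_, fun i hi k => ?_⟩
      · rcases Nat.lt_or_eq_of_le hi with hlt | rfl
        · exact ihW i (Nat.lt_succ_iff.mp hlt) k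
        · exact hWn1 k
      · rcases Nat.lt_or_eq_of_le hi with hlt | rfl
        · exact ihd i (Nat.lt_succ_iff.mp hlt) k
        · have hkey := key (iter (n + 1)) (iter n) hWn1 (ihW n le_rfl) (C * q ^ n) (fun k => ihd n le_rfl k) k
          rw [← iter_succ n] at hkey
          rw [iter_succ (n + 1)]
          calc ‖step (iter (n + 1)) k - iter (n + 1) k‖ ≤ q * (C * q ^ n) := hkey
            _ = C * q ^ (n + 1) := by ring
  have hW : ∀ n k, iter n k ∈ closedBall (c k) r := fun n k => (inv n).1 n le_rfl k
  have hd : ∀ n k, dist (iter n k) (iter (n + 1) k) ≤ C * q ^ n := fun n k => by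
    rw [dist_comm, dist_eq_norm]; exact (inv n).2 n le_rfl k
  -- pointwise limits
  have hlim : ∀ k, ∃ x : E3, Tendsto (fun n => iter n k) atTop (𝓝 x) := fun k =>
    cauchySeq_tendsto_of_complete (cauchySeq_of_le_geometric q C hq1 (fun n => hd n k))
  choose hinf hhinf using hlim
  have hdist : ∀ n k, dist (iter n k) (hinf k) ≤ C * q ^ n / (1 - q) := fun n k =>
    dist_le_of_le_geometric_of_tendsto q C hq1 (fun n => hd n k) (hhinf k) n
  have hinfW : ∀ k, hinf k ∈ closedBall (c k) r := fun k =>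
    isClosed_closedBall.mem_of_tendsto (hhinf k) (Eventually.of_forall fun n => hW n k)
  refine ⟨hinf, hinfW, fun m => ?_, fun k => ?_⟩
  · -- the limit is a zero: ‖Φ m hinf‖ ≤ ((Σκ)·C/(1−q) + ε)·qⁿ for every n
    have hbd : ∀ n : ℕ, ‖Φ m hinf‖ ≤ ((∑' j, κ j) * (C / (1 - q)) + ε) * q ^ n := by
      intro n
      have hΦn : t • Φ m (iter n) = iter n m - iter (n + 1) m := by
        rw [iter_succ, hstep, sub_sub_cancel]
      have hn1 : ‖Φ m (iter n)‖ ≤ ε * q ^ n := by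
        have h1 : ‖t • Φ m (iter n)‖ ≤ C * q ^ n := by
          rw [hΦn, ← dist_eq_norm]; exact hd n m
        rw [norm_smul, Real.norm_eq_abs, abs_of_pos ht0, hC] at h1
        have h2 : t * ‖Φ m (iter n)‖ ≤ t * (ε * q ^ n) := by linarith
        exact le_of_mul_le_mul_left h2 ht0
      have hn2 : ‖Φ m hinf - Φ m (iter n)‖ ≤ (∑' j, κ j) * (C * q ^ n / (1 - q)) := by
        refine (hlip m hinf (iter n) hinfW (hW n)).trans ?_
        have hle : ∀ j : ℤ, κ j * ‖hinf (m + j) - iter n (m + j)‖ ≤ κ j * (C * q ^ n / (1 - q)) := fun j => by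
          refine mul_le_mul_of_nonneg_left ?_ (hκ0 j)
          rw [← dist_eq_norm, dist_comm]; exact hdist n (m + j)
        calc ∑' j : ℤ, κ j * ‖hinf (m + j) - iter n (m + j)‖ ≤ ∑' j : ℤ, κ j * (C * q ^ n / (1 - q)) :=
              (hsumm hinf (iter n) hinfW (hW n) m).tsum_le_tsum hle (hκs.mul_right _)
          _ = (∑' j, κ j) * (C * q ^ n / (1 - q)) := tsum_mul_right
      calc ‖Φ m hinf‖ = ‖(Φ m hinf - Φ m (iter n)) + Φ m (iter n)‖ := by rw [sub_add_cancel]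
        _ ≤ ‖Φ m hinf - Φ m (iter n)‖ + ‖Φ m (iter n)‖ := norm_add_le _ _
        _ ≤ (∑' j, κ j) * (C * q ^ n / (1 - q)) + ε * q ^ n := add_le_add hn2 hn1
        _ = ((∑' j, κ j) * (C / (1 - q)) + ε) * q ^ n := by ring
    have hto : Tendsto (fun n : ℕ => ((∑' j, κ j) * (C / (1 - q)) + ε) * q ^ n) atTop (𝓝 0) := by
      have := (tendsto_pow_atTop_nhds_zero_of_lt_one hq0 hq1).const_mul ((∑' j, κ j) * (C / (1 - q)) + ε)
      simpa using this
    have hk : ‖Φ m hinf‖ ≤ 0 := ge_of_tendsto' hto hbd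
    exact norm_le_zero_iff.mp hk
  · -- a priori bound: dist (iter 0 k) (hinf k) ≤ C/(1−q) ≤ 4ε/(3(λ−ρ))
    have h0 := dist_le_of_le_geometric_of_tendsto₀ q C hq1 (fun n => hd n k) (hhinf k)
    rw [iter_zero, dist_comm, dist_eq_norm] at h0
    refine h0.trans ?_
    rw [div_le_div_iff₀ h1q0 (mul_pos (by norm_num) hgap), hC]
    have e1 := mul_le_mul_of_nonneg_left h1q hε0
    have e2 : t * ε * (3 * (lam - ρ)) = 4 * (ε * (3 / 4 * (t * (lam - ρ)))) := by ring
    rw [e2]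
    linarith

/-- **LJ specialisation.**  Tube data for the transmitted gap stresses `gapStress a b` on the `r`-ball round ANY centre profile `c` + residual
`‖gapStress a b m c‖ ≤ ε` with `4ε ≤ 3(λ − ρ)r` ⇒ a ZERO-STRESS increment profile within `4ε/(3(λ − ρ))` of `c` (the balanced reference; unique in
the ball by `zero_unique_of_tube_data`).  The analytic half of slot 7d `BasalReferenceCW`. [this file] -/
theorem exists_zeroStress_of_tube_data {a b : E3} {c : ℤ → E3} {r ε lam ρ : ℝ} {κ : ℤ → ℝ}
    (hε0 : 0 ≤ ε) (hκ0 : ∀ j, 0 ≤ κ j) (hκs : Summable κ) (hρ : (∑' j, κ j) - κ 0 ≤ ρ) (hρl : ρ < lam)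
    (hmono : ∀ m : ℤ, ∀ h : ℤ → E3, (∀ k, h k ∈ closedBall (c k) r) → ∀ b' ∈ closedBall (c m) r,
      lam * ‖h m - b'‖ ^ 2 ≤ ⟪gapStress a b m h - gapStress a b m (Function.update h m b'), h m - b'⟫)
    (hlip : ∀ m : ℤ, ∀ h h' : ℤ → E3, (∀ k, h k ∈ closedBall (c k) r) → (∀ k, h' k ∈ closedBall (c k) r) →
      ‖gapStress a b m h - gapStress a b m h'‖ ≤ ∑' j : ℤ, κ j * ‖h (m + j) - h' (m + j)‖)
    (hres : ∀ m, ‖gapStress a b m c‖ ≤ ε) (hεr : 4 * ε ≤ 3 * (lam - ρ) * r) :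
    ∃ h : ℤ → E3, (∀ k, h k ∈ closedBall (c k) r) ∧ (∀ m, gapStress a b m h = 0) ∧ ∀ k, ‖h k - c k‖ ≤ 4 * ε / (3 * (lam - ρ)) :=
  exists_zero_of_tube_data (Φ := gapStress a b) hε0 hκ0 hκs hρ hρl hmono hlip hres hεr

/-- **Uniqueness companion** (part XVIII's kernel on the same windows): the zero is the only one in the ball. [this file] -/
theorem zero_unique_of_tube_data {c : ℤ → E3} {r lam : ℝ} {Φ : ℤ → (ℤ → E3) → E3} {κ : ℤ → ℝ}
    (hκ0 : ∀ j, 0 ≤ κ j) (hκs : Summable κ) (hdom : (∑' j, κ j) - κ 0 < lam)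
    (hmono : ∀ m : ℤ, ∀ h : ℤ → E3, (∀ k, h k ∈ closedBall (c k) r) → ∀ b' ∈ closedBall (c m) r,
      lam * ‖h m - b'‖ ^ 2 ≤ ⟪Φ m h - Φ m (Function.update h m b'), h m - b'⟫)
    (hlip : ∀ m : ℤ, ∀ h h' : ℤ → E3, (∀ k, h k ∈ closedBall (c k) r) → (∀ k, h' k ∈ closedBall (c k) r) →
      ‖Φ m h - Φ m h'‖ ≤ ∑' j : ℤ, κ j * ‖h (m + j) - h' (m + j)‖)
    {h h' : ℤ → E3} (hh : ∀ k, h k ∈ closedBall (c k) r) (hh' : ∀ k, h' k ∈ closedBall (c k) r)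
    (hz : ∀ m, Φ m h = 0) (hz' : ∀ m, Φ m h' = 0) : h = h' := by
  have hD : ∀ k, ‖h k - h' k‖ ≤ 2 * r := fun k => by
    have h1 := hh k; have h2 := hh' k
    rw [mem_closedBall, dist_eq_norm] at h1 h2
    calc ‖h k - h' k‖ = ‖(h k - c k) - (h' k - c k)‖ := by congr 1; abel
      _ ≤ ‖h k - c k‖ + ‖h' k - c k‖ := norm_sub_le _ _
      _ ≤ 2 * r := by linarith
  exact eq_of_equal_stress (W := fun k => closedBall (c k) r) hκ0 hκs hdom hmono hlip hh hh' hD (fun m => by rw [hz m, hz' m])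

end Summit.AtomisticToContinuum.Crystallization.Theorems.OverbindingBudgetBalancedReferenceKernel

end
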